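import Mathlib
import Summits.ResolutionOfSingularities.ResolutionOfSingularities.Theorems.FrobeniusClosingSteerRankFourExitPointStep

/-!
# B7 `rankFour_exit_two`: along a 2-steered run the cleaned quadratic part has polar rank `≤ 2`
# (chain W4.1, crux `Steer` stmt-ResolutionOfSingularities-16345, σ-residual LOW half)

OURS (campaign res-hironaka, rung L, slot W4.1; helper for crux `Steer`; res-L0-w41-strat-2's one-step lemma
B7 of STRAT2-MEMO-1 §4b, typed in `L/res-L0-w41-strat-2/R2TwoSigma-s16-strat2.delta.lean` rev 2; handed to this
seat by res-L0-w41-plan-1 RULING 3 of 2026-08-27T07:20:27Z). NOT a statement of any manuscript; nothing here is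
attributed to [claim: Hironaka2017, status: under-review]. AI-written; weaker than expert review.

`rankFour_exit_two`: at a stage `i` of a σ_top-steered run at `p = 2` (members `R i`, `R (i+1)` regular of
dimension `4` with perfect residue fields, `R i` dominated by `O`), SOME cleaning `g` of the radicand `f = s_i²`
satisfies `f − g² ≡ z·w (mod 𝔪ᵢ³)` with `z, w ∈ 𝔪ᵢ` — i.e. the quadratic part of the cleaned radicand is a
product of two linear forms modulo squares: over a perfect field of characteristic `2`, quadratic forms modulo
squares of linear forms are alternating forms, of rank `0`, `2` or `4` in four variables, and RANK `4` NEVER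
OCCURS on a steered run. Two cases. (1) σ_top took a PERMISSIBLE centre `P ≠ 𝔪ᵢ`: `f − g² ∈ P²` and
`(P + 𝔪ᵢ²)/𝔪ᵢ²` is a proper subspace of the cotangent space (Nakayama), so a non-zero functional kills the
alternating form (`CotangentQuadratic.polarRank_of_mem_sq_of_ne_maximalIdeal`). (2) σ_top took the POINT: the
next member is the quadratic transform along `O`, the strict step `s_i = x·s_{i+1} + g₀` gives
`f − g₀² = x²·s_{i+1}²`, and at stage `i + 1` σ_top has a centre, so some `s_{i+1}² − g₁²` lies in `𝔪ᵢ₊₁²`;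
then `RankFourExit.polarRank_of_pointStep` (the cotangent-derivation argument) applies.

Shape: stated over an ABSTRACT permissibility predicate `Perm` (only «`Perm S f P → P ≠ 𝔪 ∧ P` prime `∧
∃ g, f − g² ∈ P²`» is consumed), the run clause being the skeleton's `IsSteeredRun` unfolded exactly as in
`SteeredRun.isRegularLocalRing_of_steeredRunUpTo`; the holder instantiates `Perm := IsPermissibleCentre · 2`.
Binders follow strat-2's signature of record (§σ2.16 delta rev 5/8: `hR` = every member is a `locAtCentre · O`,
hence dominated by `O`; `hdim'` as in B4); `hirr`, `t`, `s 0 = t` are not needed and omitted. [folklore]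
-/

noncomputable section

-- `Summit.<S>.<S>.…` duplicates the summit name by design (single-problem summit).
set_option linter.dupNamespace false

namespace Summit.ResolutionOfSingularities.ResolutionOfSingularities.Theorems.SwitchingDichotomy.RankFourExit

open IsLocalRing Module Literature.AlgebraicGeometry.Resolution
open Summit.ResolutionOfSingularities.ResolutionOfSingularities.Theorems.SwitchingDichotomy

-- `K : Type` (universe `0`) as in the skeleton of record.
variable {K : Type} [Field K]

/-- A regular local ring of Krull dimension `4` has a `4`-dimensional cotangent space (bookkeeping). [folklore] -/
theorem finrank_cotangentSpace_eq_four (S : Type) [CommRing S] [IsRegularLocalRing S]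
    (hdim : ringKrullDim S = 4) : finrank (ResidueField S) (CotangentSpace S) = 4 := by
  have h := (IsRegularLocalRing.iff_finrank_cotangentSpace S).mp inferInstance
  rw [hdim] at h
  exact_mod_cast h

/-- **B7, one stage, primitive form.** `R ⊆ O` a regular local subring of dimension `4` dominated by `O`
(characteristic `2`, residues of `R` and of the next member `R₁` squares), `f ∈ R` the radicand, `P` the centre
σ_top took at this stage: EITHER a proper centre with `f − g² ∈ P²`, OR the point — in which case `R₁` is the
quadratic transform along `O`, `s = x·s₁ + g₀` is the strict step (`x ∈ 𝔪_R`) with `f = s²`, `s₁² ∈ R₁`, and at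
the next stage some cleaning `s₁² − g₁²` lies in `𝔪₁²`. Then `f ≡ g² + z·w (mod 𝔪_R³)` with `z, w ∈ 𝔪_R`.
[folklore] -/
theorem polarRank_le_two_of_stage [CharP K 2] (O : ValuationSubring K) (R R₁ : Subring K)
    [IsRegularLocalRing R] [IsRegularLocalRing R₁] (hdim : ringKrullDim R = 4) (hdim' : ringKrullDim R₁ = 4)
    (hdom : SubringDominates R O.toSubring)
    (hperf : ∀ a : R, ∃ b : R, a - b ^ 2 ∈ maximalIdeal R)
    (hperf' : ∀ a : R₁, ∃ b : R₁, a - b ^ 2 ∈ maximalIdeal R₁)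
    {s s₁ : K} (hs : s ^ 2 ∈ R) (hs₁ : s₁ ^ 2 ∈ R₁) (P : Ideal R)
    (hcentre : (P ≠ maximalIdeal R ∧ P.IsPrime ∧ ∃ g : R, (⟨s ^ 2, hs⟩ : R) - g ^ 2 ∈ P ^ 2) ∨
      (P = maximalIdeal R ∧ IsLocalBlowupAlong O R P R₁ ∧
        (∃ x g₀ : K, ((∃ hx : x ∈ R, (⟨x, hx⟩ : R) ∈ P) ∧ x ≠ 0 ∧
            ∀ y : R, y ∈ P → O.valuation (y : K) ≤ O.valuation x) ∧ g₀ ∈ R ∧ s = x * s₁ + g₀) ∧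
        ∃ g₁ : R₁, (⟨s₁ ^ 2, hs₁⟩ : R₁) - g₁ ^ 2 ∈ maximalIdeal R₁ ^ 2)) :
    ∃ g z w : R, z ∈ maximalIdeal R ∧ w ∈ maximalIdeal R ∧
      (⟨s ^ 2, hs⟩ : R) - g ^ 2 - z * w ∈ maximalIdeal R ^ 3 := by
  have h4 : finrank (ResidueField R) (CotangentSpace R) = 4 := finrank_cotangentSpace_eq_four R hdim
  have h2R : (2 : R) = 0 := by
    have := CharP.cast_eq_zero R 2
    simpa using this
  rcases hcentre with ⟨hne, hprime, g, hg⟩ | ⟨hP, hbl, ⟨x, g₀, ⟨⟨hxR, hxP⟩, hx0, hxmax⟩, hg₀, hstep⟩, hnext⟩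
  · -- (1) permissible centre
    have hPle : P ≤ maximalIdeal R := IsLocalRing.le_maximalIdeal hprime.ne_top
    obtain ⟨g', z, w, hz, hw, h⟩ :=
      CotangentQuadratic.polarRank_of_mem_sq_of_ne_maximalIdeal hperf h4 P hPle hne hg
    refine ⟨g + g', z, w, hz, hw, ?_⟩
    have e : (⟨s ^ 2, hs⟩ : R) - (g + g') ^ 2 - z * w =
        ((⟨s ^ 2, hs⟩ : R) - g ^ 2 - g' ^ 2 - z * w) - (g * g') * 2 := by ring
    rw [e, h2R, mul_zero, sub_zero]
    exact h
  · -- (2) point step: `R₁` is the quadratic transform along `O`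
    subst hP
    have hQT : IsQuadraticTransformAlong O R R₁ := ⟨inferInstance, hbl⟩
    have h4' : finrank (ResidueField R₁) (CotangentSpace R₁) = 4 := finrank_cotangentSpace_eq_four R₁ hdim'
    have hRO : R ≤ O.toSubring := hQT.source_le
    have hvx : O.valuation x < 1 :=
      ((subringDominates_valuationSubring_iff hRO).mp hdom ⟨x, hxR⟩).mp hxP
    exact polarRank_of_pointStep hQT hdom h4 h4' hperf hperf' hs hs₁ hxR hvx hg₀ hstep hnext

/-- **B7 `rankFour_exit_two` (res-L0-w41-strat-2, STRAT2-MEMO-1 §4b; LOW half of the σ-residual at `p = 2`).**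
At EVERY stage `i` of a σ_top-steered run at `p = 2` whose members `R i`, `R (i+1)` are regular of dimension `4`
with perfect residue fields (every residue a square), all members being localisations at the centre of `O`
(`hR`), the cleaned quadratic part
of the radicand has polar rank `≤ 2`: `s_i² ≡ g² + z·w (mod 𝔪ᵢ³)` for some `g ∈ R i`, `z, w ∈ 𝔪ᵢ`. The run clause
is the skeleton's `IsSteeredRun O R P t 2 s` unfolded over an abstract permissibility predicate `Perm` (only
«`Perm S f P → P ≠ 𝔪 ∧ P` prime `∧ ∃ g, f − g² ∈ P²`» is used, as for `IsPermissibleCentre S 2 f P`).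
OURS; replaces the role of no printed item; NOT a statement of the manuscript. [folklore] -/
theorem rankFour_exit_two [CharP K 2]
    (Perm : ∀ S : Subring K, IsLocalRing S → S → Ideal S → Prop)
    (hPerm : ∀ (S : Subring K) (hS : IsLocalRing S) (f : S) (P : Ideal S),
      Perm S hS f P → P ≠ maximalIdeal S ∧ P.IsPrime ∧ ∃ g : S, f - g ^ 2 ∈ P ^ 2)
    (O : ValuationSubring K) (R : ℕ → Subring K) (P : (i : ℕ) → Ideal (R i)) (s : ℕ → K)
    (hrun : ∀ i, ∃ (hL : IsLocalRing (R i)) (hs : s i ^ 2 ∈ R i),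
      (Perm (R i) hL ⟨s i ^ 2, hs⟩ (P i) ∨
        (P i = maximalIdeal (R i) ∧ (∀ Q : Ideal (R i), ¬ Perm (R i) hL ⟨s i ^ 2, hs⟩ Q) ∧
          ∃ g : R i, (⟨s i ^ 2, hs⟩ : R i) - g ^ 2 ∈ maximalIdeal (R i) ^ 2)) ∧
      IsLocalBlowupAlong O (R i) (P i) (R (i + 1)) ∧
      ∃ x g : K, ((∃ hx : x ∈ R i, (⟨x, hx⟩ : R i) ∈ P i) ∧ x ≠ 0 ∧
        ∀ y : R i, y ∈ P i → O.valuation (y : K) ≤ O.valuation x) ∧ g ∈ R i ∧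
        s i = x * s (i + 1) + g)
    (i : ℕ) (hR : ∀ j, ∃ B : Subring K, B ≤ O.toSubring ∧ R j = locAtCentre B O)
    (hreg : IsRegularLocalRing (R i)) (hreg' : IsRegularLocalRing (R (i + 1)))
    (hdim : ringKrullDim (R i) = 4) (hdim' : ringKrullDim (R (i + 1)) = 4)
    (hperf : ∀ j, ∀ (_ : IsLocalRing (R j)) (a : R j), ∃ b : R j, a - b ^ 2 ∈ maximalIdeal (R j)) :
    ∃ (_ : IsLocalRing (R i)) (hs : s i ^ 2 ∈ R i) (g z w : R i),
      z ∈ maximalIdeal (R i) ∧ w ∈ maximalIdeal (R i) ∧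
      (⟨s i ^ 2, hs⟩ : R i) - g ^ 2 - z * w ∈ maximalIdeal (R i) ^ 3 := by
  obtain ⟨hL, hs, hC, hbl, hstrict⟩ := hrun i
  obtain ⟨hL', hs', hC', -, -⟩ := hrun (i + 1)
  haveI := hreg
  haveI := hreg'
  have hdom : SubringDominates (R i) O.toSubring := by
    obtain ⟨B, hB, hRi⟩ := hR i
    rw [hRi]
    exact subringDominates_locAtCentre hB
  refine ⟨inferInstance, hs, ?_⟩
  refine polarRank_le_two_of_stage O (R i) (R (i + 1)) hdim hdim' hdom (hperf i inferInstance)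
    (hperf (i + 1) inferInstance) hs hs' (P i) ?_
  rcases hC with hperm | ⟨hPi, -, -⟩
  · obtain ⟨hne, hprime, hg⟩ := hPerm _ hL _ _ hperm
    exact Or.inl ⟨hne, hprime, hg⟩
  · refine Or.inr ⟨hPi, hbl, hstrict, ?_⟩
    -- at stage `i + 1` σ_top has a centre: some cleaning of `s (i+1) ^ 2` lies in `𝔪²`
    rcases hC' with hperm' | ⟨-, -, g₁, hg₁⟩
    · obtain ⟨-, hprime', g₁, hg₁⟩ := hPerm _ hL' _ _ hperm'
      exact ⟨g₁, Ideal.pow_right_mono (IsLocalRing.le_maximalIdeal hprime'.ne_top) 2 hg₁⟩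
    · exact ⟨g₁, hg₁⟩

end Summit.ResolutionOfSingularities.ResolutionOfSingularities.Theorems.SwitchingDichotomy.RankFourExit

end
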